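import Summits.NavierStokesRegularity.NavierStokesRegularity.Theses.TautLoopKelvin
import Summits.NavierStokesRegularity.NavierStokesRegularity.Theorems.RungReynoldsOne.Negative.WithoutLerayHopfFalse
import Literature.Analysis.FluidPDE.NSQuasipotential

/-!
# `CirculationFloor` (stmt-NavierStokesRegularity-1538): the classical hypothesis is load-bearing

Negative (support) lemma for the crux `TautLoopKelvin.CirculationFloor` = `CirculationRelay.CirculationFloor`
(shared entry ticket stmt-NavierStokesRegularity-1538; routes TautLoopKelvin rank 4, CirculationRelay rank 9),
from the crux disprover's work file `Cruxes/CirculationFloor/Disproof.lean` (cdisprove seat, 2026-08-17). It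
completes the load-bearing table of `Negative/LoadBearing.lean` (`¬ HasSmoothExtensionPast` and `IsLerayHopfOn`
load-bearing; `0 < ν`, `0 < T` decoration) with the remaining testable hypothesis:

* `circulationFloor_false_without_classical` — drop `IsClassicalNSSolutionOn (Ico 0 T) ν 0 u p`: FALSE. Witness
  (`ν = T = 1`, `δ = c₀/(8π)`): the POINT SPIKE `u t x = if t = 1/2 ∧ x = 0 then e₀ else 0` on the rest state.
  Every slice is a.e. zero, so `u` is a Leray–Hopf solution from the Schwartz datum `0` (all Leray–Hopf clauses are
  integrals or a.e.-in-time statements: `isLerayHopfOn_of_sliceNull`); no classical flow agrees with `u` on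
  `[0, 1)` because the slice `u (1/2)` is discontinuous (`not_hasSmoothExtensionPast_of_pointSpike`), so
  `¬ HasSmoothExtensionPast` holds for free; and every circle integral of a field bounded by `1` is at most `4πr`
  (`abs_circleIntegral_le_of_norm_le_one`), hence `< c₀` on circles of radius `≤ c₀/(8π)`.

MORAL for provers. The two hypotheses `IsLerayHopfOn` (integral, a.e.) and `¬ HasSmoothExtensionPast` do not see
a single slice value, while the conclusion is a POINTWISE line integral: it is the joint space–time smoothness in
`IsClassicalNSSolutionOn` that (i) makes "no smooth extension past `T`" a genuine singularity rather than a defect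
of the representative, and (ii) makes `∮ u(t)·dl = ∫_D curl u(t)·n` (Stokes on discs, stub
`stub_ballFlux_of_smallCircles` of the birth line) available. Any proof must use the classical hypothesis at the
level of slice regularity, not only through the equation.

[cite: KochNadirashviliSereginSverak2009, §1 p. 3 (parasitic / non-unique representatives outside the energy–smoothness class)]
-/

noncomputable section

set_option linter.dupNamespace false

namespace Summit.NavierStokesRegularity.NavierStokesRegularity.Theorems.CirculationFloor.Negative

open Set Filter Topology MeasureTheory Real Function
open scoped InnerProductSpace RealInnerProductSpace ENNReal Laplacian
open Literature.Analysis.FluidPDE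
open Summit.NavierStokesRegularity.NavierStokesRegularity.Theorems.RungReynoldsOneNegative

/-! ## Slice-null flows are Leray–Hopf from rest -/

section SliceNull

variable {u : ℝ → (EuclideanSpace ℝ (Fin 3)) → (EuclideanSpace ℝ (Fin 3))}

/-- **A slice-wise null flow is a Leray–Hopf solution from rest.** If `u : ℝ → ℝ³ → ℝ³` is jointly measurable,
bounded by `1`, vanishes identically off the instant `t = 1/2`, and its slice at every instant is a.e. zero, then
`u` is a Leray–Hopf weak solution of unforced Navier–Stokes on `[0, T)` from the datum `0`, for every `T` and every
viscosity: every clause of `IsLerayHopfOn` is an integral identity / bound (blind to null sets) or an a.e.-in-time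
statement (blind to the instant `1/2`), with weak gradient `G = 0`. [folklore] -/
theorem isLerayHopfOn_of_sliceNull (hmeas : Measurable (uncurry u)) (hbd : ∀ t x, ‖u t x‖ ≤ 1)
    (hoff : ∀ t : ℝ, t ≠ 2⁻¹ → u t = 0) (hnull : ∀ t, u t =ᵐ[volume] (0 : (EuclideanSpace ℝ (Fin 3)) → (EuclideanSpace ℝ (Fin 3)))) (T ν : ℝ) :
    IsLerayHopfOn T ν 0 (0 : (EuclideanSpace ℝ (Fin 3)) → (EuclideanSpace ℝ (Fin 3))) u where
  weak := by
    have hae : ∀ᵐ t ∂(volume.restrict (Ioo (0:ℝ) T)), t ≠ 2⁻¹ :=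
      ae_restrict_of_ae (measure_eq_zero_iff_ae_notMem.1 (measure_singleton (2⁻¹ : ℝ)))
    refine ⟨hmeas.aestronglyMeasurable, fun K hK => ?_, ?_, fun ψ _ _ => ?_⟩
    · -- local square integrability: integrand bounded by `1` on a set of finite measure
      have hle : ∀ z, ‖uncurry u z‖ₑ ^ 2 ≤ (1 : ℝ≥0∞) := by
        intro z
        have h1 : ‖uncurry u z‖ₑ ≤ ‖(1 : ℝ)‖ₑ := by
          rw [enorm_le_iff_norm_le, Real.norm_eq_abs, abs_one]
          exact hbd z.1 z.2
        calc ‖uncurry u z‖ₑ ^ 2 ≤ ‖(1 : ℝ)‖ₑ ^ 2 := by gcongr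
          _ = 1 := by simp
      calc ∫⁻ z in Ioo (0:ℝ) T ×ˢ K, ‖uncurry u z‖ₑ ^ 2
          ≤ ∫⁻ _ in Ioo (0:ℝ) T ×ˢ K, (1 : ℝ≥0∞) := lintegral_mono fun z => hle z
        _ = volume (Ioo (0:ℝ) T ×ˢ K) := by rw [setLIntegral_const, one_mul]
        _ < ∞ := by
          rw [Measure.volume_eq_prod, Measure.prod_prod]
          exact ENNReal.mul_lt_top (by simp) hK.measure_lt_top
    · filter_upwards [hae] with t ht
      rw [hoff t ht]
      intro θ _
      simp
    · have h : (fun t => ∫ x, (⟪u t x, timeDeriv ψ t x⟫ + ⟪u t x, convect (u t) (ψ t) x⟫ +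
          ν * ⟪u t x, Δ (ψ t) x⟫ + ⟪(0 : ℝ → (EuclideanSpace ℝ (Fin 3)) → (EuclideanSpace ℝ (Fin 3))) t x, ψ t x⟫)) =ᵐ[volume.restrict (Ioo (0:ℝ) T)]
          fun _ => (0 : ℝ) := by
        filter_upwards [hae] with t ht
        simp [hoff t ht]
      rw [integral_congr_ae h]
      simp
  energy_bound := ⟨0, by
    filter_upwards [ae_restrict_of_ae (measure_eq_zero_iff_ae_notMem.1 (measure_singleton (2⁻¹ : ℝ)))]
      with t ht
    simp [hoff t ht, eEnergy]⟩
  memLp := fun t _ => (MemLp.zero' : MemLp (0 : (EuclideanSpace ℝ (Fin 3)) → (EuclideanSpace ℝ (Fin 3))) 2 volume).ae_eq (hnull t).symm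
  weakGrad_energy := by
    have hkin : ∀ t, VectorCalculus.kineticEnergy (u t) = 0 := by
      intro t
      unfold VectorCalculus.kineticEnergy
      have h : (fun x => ‖u t x‖ ^ 2) =ᵐ[volume] fun _ => (0 : ℝ) := by
        filter_upwards [hnull t] with x hx
        simp [hx]
      rw [integral_congr_ae h]
      simp
    refine ⟨fun _ _ => 0, ?_, by simp, fun t _ => ?_, ae_of_all _ fun s t _ => ?_⟩
    · filter_upwards [ae_restrict_of_ae (measure_eq_zero_iff_ae_notMem.1 (measure_singleton (2⁻¹ : ℝ)))]
        with t ht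
      rw [hoff t ht]
      simpa using (hasWeakGradient_zero (E := (EuclideanSpace ℝ (Fin 3))))
    · rw [hkin]
      simp [VectorCalculus.kineticEnergy]
    · rw [hkin, hkin]
      simp
  weak_continuous := fun w _ => by
    have key : (fun t => ∫ x, ⟪u t x, w x⟫) = fun _ => (0 : ℝ) := by
      funext t
      have h : (fun x => ⟪u t x, w x⟫) =ᵐ[volume] fun _ => (0 : ℝ) := by
        filter_upwards [hnull t] with x hx
        simp [hx]
      rw [integral_congr_ae h]
      simp
    refine ⟨by rw [key]; exact continuousOn_const, ?_⟩
    rw [key]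
    simp
  strong_initial := by
    have key : (fun t => eLpNorm (u t - 0) 2 volume) = fun _ => (0 : ℝ≥0∞) := by
      funext t
      rw [sub_zero, eLpNorm_congr_ae (hnull t)]
      exact eLpNorm_zero
    rw [key]
    exact tendsto_const_nhds

end SliceNull

/-! ## A point spike has no smooth extension -/

/-- **A flow with a point-spike slice has no smooth extension.** If at some instant `t₀ ∈ [0, T)` the slice
`u t₀` vanishes off a point `x₀` but not at `x₀`, then no classical solution on any `[0, T')`, `T' > T`, agrees
with `u` on `[0, T)`: its slice at `t₀` would be continuous, equal to `0` on the dense set `{x₀}ᶜ`, hence `0` at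
`x₀`. (So for non-smooth `u` the hypothesis `¬ HasSmoothExtensionPast` holds for free.) [folklore] -/
theorem not_hasSmoothExtensionPast_of_pointSpike {u : ℝ → (EuclideanSpace ℝ (Fin 3)) → (EuclideanSpace ℝ (Fin 3))} {T t₀ : ℝ} (ht₀ : t₀ ∈ Ico 0 T) (x₀ : (EuclideanSpace ℝ (Fin 3)))
    (hoff : ∀ x, x ≠ x₀ → u t₀ x = 0) (hne : u t₀ x₀ ≠ 0) (ν : ℝ) : ¬ HasSmoothExtensionPast ν 0 u T := by
  rintro ⟨T', hT', u', p', hcl, heq⟩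
  have hcont : Continuous (u' t₀) := (hcl.contDiff_velocity ⟨ht₀.1, ht₀.2.trans hT'⟩).continuous
  have hslice : u' t₀ = u t₀ := heq _ ht₀
  have hzero : u' t₀ = fun _ => (0 : (EuclideanSpace ℝ (Fin 3))) := by
    refine hcont.ext_on (dense_compl_singleton x₀) continuous_const (fun x hx => ?_)
    rw [hslice]
    exact hoff x hx
  exact hne (by rw [← hslice, hzero])

/-! ## Circle integrals of bounded fields -/

/-- **Crude bound for the route's circle integral**: a field bounded by `1` in norm has
`|∫₀^{2π} ⟪v(c + r cos θ e₁ + r sin θ e₂), −r sin θ e₁ + r cos θ e₂⟫ dθ| ≤ 4πr` for unit `e₁, e₂` and `r > 0`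
(integrand bounded by `‖v‖ · 2r`; no integrability needed, `intervalIntegral.norm_integral_le_of_norm_le_const`). [folklore] -/
theorem abs_circleIntegral_le_of_norm_le_one (v : (EuclideanSpace ℝ (Fin 3)) → (EuclideanSpace ℝ (Fin 3))) (hv : ∀ x, ‖v x‖ ≤ 1) (c e₁ e₂ : (EuclideanSpace ℝ (Fin 3))) {r : ℝ}
    (hr : 0 < r) (he₁ : ‖e₁‖ = 1) (he₂ : ‖e₂‖ = 1) :
    |∫ θ in (0 : ℝ)..(2 * Real.pi), inner ℝ (v (c + (r * Real.cos θ) • e₁ + (r * Real.sin θ) • e₂))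
      ((-(r * Real.sin θ)) • e₁ + (r * Real.cos θ) • e₂)| ≤ 4 * Real.pi * r := by
  have hbound : ∀ θ ∈ Set.uIoc (0:ℝ) (2 * Real.pi),
      ‖inner ℝ (v (c + (r * Real.cos θ) • e₁ + (r * Real.sin θ) • e₂))
        ((-(r * Real.sin θ)) • e₁ + (r * Real.cos θ) • e₂)‖ ≤ 2 * r := by
    intro θ _
    have h1 : ‖(-(r * Real.sin θ)) • e₁ + (r * Real.cos θ) • e₂‖ ≤ r + r := by
      refine (norm_add_le _ _).trans (add_le_add ?_ ?_)
      · rw [norm_smul, he₁, mul_one, norm_neg, Real.norm_eq_abs, abs_mul, abs_of_pos hr]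
        exact mul_le_of_le_one_right hr.le (Real.abs_sin_le_one _)
      · rw [norm_smul, he₂, mul_one, Real.norm_eq_abs, abs_mul, abs_of_pos hr]
        exact mul_le_of_le_one_right hr.le (Real.abs_cos_le_one _)
    rw [Real.norm_eq_abs]
    refine (abs_real_inner_le_norm _ _).trans ?_
    have h2 := hv (c + (r * Real.cos θ) • e₁ + (r * Real.sin θ) • e₂)
    nlinarith [norm_nonneg (v (c + (r * Real.cos θ) • e₁ + (r * Real.sin θ) • e₂)),
      norm_nonneg ((-(r * Real.sin θ)) • e₁ + (r * Real.cos θ) • e₂)]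
  have h4 := intervalIntegral.norm_integral_le_of_norm_le_const hbound
  rw [sub_zero, abs_of_pos Real.two_pi_pos] at h4
  rw [← Real.norm_eq_abs]
  linarith

/-! ## The classical hypothesis is load-bearing -/

/-- **`IsClassicalNSSolutionOn` is load-bearing.** `CirculationFloor` with the classical-solution hypothesis
deleted (the pressure `p` then no longer occurs) is FALSE: for `ν = T = 1` the point spike
`u t x = if t = 1/2 ∧ x = 0 then e₀ else 0` (`e₀ = EuclideanSpace.single 0 1`) is Leray–Hopf from the
Schwartz datum `0` (`isLerayHopfOn_of_sliceNull`), admits no smooth extension past `1`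
(`not_hasSmoothExtensionPast_of_pointSpike`), and all its circle integrals on circles of radius `r ≤ c₀/(8π)` are
`≤ 4πr ≤ c₀/2 < c₀` (`abs_circleIntegral_le_of_norm_le_one`). [folklore] -/
theorem circulationFloor_false_without_classical :
    ¬ (∃ c₀ : ℝ, 0 < c₀ ∧ ∀ (ν T : ℝ), 0 < ν → 0 < T →
      ∀ (u : ℝ → EuclideanSpace ℝ (Fin 3) → EuclideanSpace ℝ (Fin 3)),
        IsLerayHopfOn T ν 0 (u 0) u → HasRapidSpatialDecay (u 0) → ¬ HasSmoothExtensionPast ν 0 u T →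
        ∀ δ : ℝ, 0 < δ → ∃ t ∈ Set.Ico 0 T, ∃ (c e₁ e₂ : EuclideanSpace ℝ (Fin 3)) (r : ℝ),
          0 < r ∧ r ≤ δ ∧ ‖e₁‖ = 1 ∧ ‖e₂‖ = 1 ∧ inner ℝ e₁ e₂ = 0 ∧
          c₀ * ν ≤ |∫ θ in (0 : ℝ)..(2 * Real.pi), inner ℝ (u t (c + (r * Real.cos θ) • e₁ + (r * Real.sin θ) • e₂))
            ((-(r * Real.sin θ)) • e₁ + (r * Real.cos θ) • e₂)|) := by
  rintro ⟨c₀, hc₀, h⟩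
  -- the witness: the point spike on the rest state
  set e₀ : (EuclideanSpace ℝ (Fin 3)) := EuclideanSpace.single 0 1 with he₀
  have he₀n : ‖e₀‖ = 1 := by rw [he₀]; simp
  have he₀ne : e₀ ≠ 0 := by
    intro h0
    rw [h0, norm_zero] at he₀n
    exact zero_ne_one he₀n
  set u : ℝ → (EuclideanSpace ℝ (Fin 3)) → (EuclideanSpace ℝ (Fin 3)) := fun t x => if t = 2⁻¹ ∧ x = 0 then e₀ else 0 with hu
  have hoff : ∀ t : ℝ, t ≠ 2⁻¹ → u t = 0 := fun t ht => by
    funext x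
    simp [hu, ht]
  have hu0 : u 0 = 0 := hoff 0 (by norm_num)
  have hnull : ∀ t, u t =ᵐ[volume] (0 : (EuclideanSpace ℝ (Fin 3)) → (EuclideanSpace ℝ (Fin 3))) := by
    intro t
    filter_upwards [measure_eq_zero_iff_ae_notMem.1 (measure_singleton (0 : (EuclideanSpace ℝ (Fin 3))))] with x hx
    simp only [mem_singleton_iff] at hx
    simp [hu, hx]
  have hbd : ∀ t x, ‖u t x‖ ≤ 1 := by
    intro t x
    simp only [hu]
    split_ifs
    · exact he₀n.le
    · simp
  have hmeas : Measurable (uncurry u) := by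
    have hs : MeasurableSet {z : ℝ × (EuclideanSpace ℝ (Fin 3)) | z.1 = 2⁻¹ ∧ z.2 = 0} :=
      (measurable_fst (measurableSet_singleton (2⁻¹ : ℝ))).inter
        (measurable_snd (measurableSet_singleton (0 : (EuclideanSpace ℝ (Fin 3)))))
    exact Measurable.ite hs measurable_const measurable_const
  -- the three dropped-hypothesis companions hold
  have hLH : IsLerayHopfOn 1 1 0 (u 0) u := by
    rw [hu0]
    exact isLerayHopfOn_of_sliceNull hmeas hbd hoff hnull 1 1
  have hdec : HasRapidSpatialDecay (u 0) := by
    rw [hu0]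
    simpa [drift_zero (gI_zero 1)] using drift_rapidDecay (g := gI 1) (gI_zero 1)
  have hext : ¬ HasSmoothExtensionPast 1 0 u 1 := by
    refine not_hasSmoothExtensionPast_of_pointSpike (u := u) (t₀ := 2⁻¹) ⟨by norm_num, by norm_num⟩ 0
      (fun x hx => by simp [hu, hx]) ?_ 1
    simpa [hu] using he₀ne
  -- but no circle of radius ≤ c₀/(8π) carries c₀
  have hδ : 0 < c₀ / (8 * Real.pi) := by positivity
  obtain ⟨t, -, c, e₁, e₂, r, hr, hrδ, he₁, he₂, -, hle⟩ := h 1 1 one_pos one_pos u hLH hdec hext _ hδ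
  have hb := abs_circleIntegral_le_of_norm_le_one (u t) (hbd t) c e₁ e₂ hr he₁ he₂
  have h5 : 4 * Real.pi * r ≤ c₀ / 2 :=
    calc 4 * Real.pi * r ≤ 4 * Real.pi * (c₀ / (8 * Real.pi)) := mul_le_mul_of_nonneg_left hrδ (by positivity)
      _ = c₀ / 2 := by field_simp; ring
  linarith

end Summit.NavierStokesRegularity.NavierStokesRegularity.Theorems.CirculationFloor.Negative

end
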